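import Literature.NumberTheory.Automorphic.WhittakerCoeffLocalDatum
import Literature.NumberTheory.Automorphic.AdicCompletionResidueCard
import Literature.NumberTheory.GaloisRepresentations.HeckeCharacter
import HarnessLib

/-!
# Two dictionary lines at a finite place: the chosen uniformizer is a uniformizing element; `q_v = N(v)`

Topic `NumberTheory/Automorphic`; proof file (two theorems: no definition, no named fact, no instance); count-neutral.  Glue between
the GLOBAL currencies of the Hecke-character files (`HeckeCharacter.uniformizer K v : K_vˣ`, `HeckeCharacter.valueAtUniformizer`,
`Ideal.absNorm v.asIdeal`) and the LOCAL currencies of the `GL_n` Satake files (`IsUniformizingElement ϖ`,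
`residueFieldCard K_v`), needed verbatim by the d6 line of cell hodgecm-mathlib (S4 assembly: the local eigenvalue theorems are
stated with `Units.mk0 ϖ _`, `IsUniformizingElement ϖ` and `residueFieldCard`, the registered target with
`HeckeCharacter.uniformizer` and `Ideal.absNorm`):

* `isUniformizingElement_heckeCharacterUniformizer` — `IsUniformizingElement ((HeckeCharacter.uniformizer K v : K_vˣ) : K_v)`
  (`HeckeCharacter.valued_uniformizer` + `isUniformizingElement_of_valued_eq`);
* `residueFieldCard_adicCompletion_eq_absNorm` — `residueFieldCard K_v = Ideal.absNorm v.asIdeal`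
  (`residueFieldCard_adicCompletion_eq`; `HeightOneSpectrum.residueCard` is `Ideal.absNorm` by definition).

References: Neukirch, *Algebraic Number Theory*, Ch. II §3–§4 (uniformizers, residue fields of completions).
-/

noncomputable section

open NumberField IsDedekindDomain

namespace Literature.NumberTheory.Automorphic

variable (K : Type) [Field K] [NumberField K] (v : HeightOneSpectrum (𝓞 K))

/-- **The chosen uniformizer `ϖ_v ∈ K_vˣ` of the Hecke-character files is a uniformizing element of `𝒪[K_v]`** (it has
valuation `exp (-1)`). [cite: NeukirchANT1999, Ch. II §3] -/
theorem isUniformizingElement_heckeCharacterUniformizer :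
    IsUniformizingElement
      ((GaloisRepresentations.HeckeCharacter.uniformizer K v : (v.adicCompletion K)ˣ) : v.adicCompletion K) :=
  isUniformizingElement_of_valued_eq K v (GaloisRepresentations.HeckeCharacter.valued_uniformizer (K := K) (v := v))

/-- **`q_v = N(v)`**: the residue cardinality of the local field `K_v` is the absolute norm of `v`.
[cite: NeukirchANT1999, Ch. II Prop. (4.3)] -/
theorem residueFieldCard_adicCompletion_eq_absNorm :
    GaloisRepresentations.IsNonarchimedeanLocalField.residueFieldCard (v.adicCompletion K) = Ideal.absNorm v.asIdeal :=
  residueFieldCard_adicCompletion_eq K v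

end Literature.NumberTheory.Automorphic

end
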